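import Summits.Ventures.CertifiedArithmetic.LowPrec.GemmTieChains

/-!
# Tie chains (IV): half-ulp chains — `W(n) ≥ (n-1)u/(1+(n-1)u)` for FP8 and FP6 products into `bfloat16`

HONEST FRAMING (venture CertifiedArithmetic / cell `pub-lowprec`): certified error envelopes and
provably optimal rounding/accumulation schemes for low-precision formats under stated cost models;
every table by two implementations; no hardware or vendor claims.

The simplest stationary witness of sequential round-to-nearest-even accumulation in `bfloat16`
(`u = 2⁻⁸`): a power of two `-2^(j+8)` followed by half-ulps `-2^j`; every partial sum
`-(2^(j+8) + 2^j)` is a tie and resolves to the even neighbour `-2^(j+8)`, so after `k` additions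
(length `n = k + 1`) `ŝ = -2^(j+8)`, `|ŝ - s| = k·2^j`, `Σ|pᵢ| = 2^(j+8) + k·2^j` and
`|ŝ - s| / Σ|pᵢ| = k/(256 + k) = (n-1)u/(1+(n-1)u)` — the shape of the sharp model-level constant
of Lange–Rump for recursive summation (there under the hypothesis `n-1 ≤ ½u⁻¹`). The point of this
file is that the two letters ARE PRODUCTS of data of the small formats, so the family lives inside
the product alphabets of `paper/gemm.tex` §Products:

* `fp8_bf16 = (-2^16, -2^8, -2^8, …)`: `2^16 = 256·256`, `2^8 = 16·16` with `256, 16` data of BOTH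
  OCP FP8 formats — one family for `E4M3²`, `E5M2²` and `E4M3×E5M2` (`fp8_bf16_letters_*`);
* `e3m2_bf16 = (-2^8, -1, -1, …)`: `256 = 16·16`, `1 = 1·1` in `E3M2`;
* `e2m3_bf16 = (-2^4, -1/16, -1/16, …)`: `16 = 4·4`, `1/16 = ¼·¼` in `E2M3`.

(`E2M1²` has no such pair of letters — its certified law `max((n-2)/(286+n), (n-3)/(253+n))`,
`GemmTieChainFamilies.lean`, is strictly below `(n-1)/(n+255)`.) Consequences recorded here, for
EVERY length `n ≥ 1`: the accumulator is constant (`*_spec`), no step leaves the finite range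
(`*_inRange`), and the error-to-mass ratio is exactly `(n-1)/(n+255)` (`*_ratio`,
`ratio_eq_unitRoundoff`). These are lower bounds `W(n) ≥ (n-1)u/(1+(n-1)u)` for the five
alphabets; whether the family is OPTIMAL at a given `n` (it is for every certified row so far, and
the model-level theorem makes it optimal for `n - 1 ≤ 128` whenever all products are `bfloat16`
numbers, as they are for FP8 and FP6 pairs) is the content of the two-implementation certificate
rows of `GEMM-BOUNDS.md`, not of this file. Prefix facts by `decide +kernel`, tails by
`tieChain_spec` (engine `GemmTieChains.lean`).
-/

namespace Literature.ComputerArithmetic.FloatingPoint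

namespace MiniFloat

open Finset

namespace TieChain

open Format

/-- `(-2^16, -2^8, -2^8, …)`: `-65536 - 256` ties to `-65536 = -2^16` (even). [folklore] -/
def fp8_bf16 : ℕ → ℚ := fun k => ([-65536] : List ℚ).getD k (-256)

/-- `(-2^8, -1, -1, …)`: `-256 - 1` ties to `-256` (even). [folklore] -/
def e3m2_bf16 : ℕ → ℚ := fun k => ([-256] : List ℚ).getD k (-1)

/-- `(-2^4, -1/16, -1/16, …)`: `-16 - 1/16` ties to `-16` (even). [folklore] -/
def e2m3_bf16 : ℕ → ℚ := fun k => ([-16] : List ℚ).getD k (-1 / 16)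

/-! #### Letters are products of data of the small formats -/

/-- Every letter of `fp8_bf16` is a product of two `E4M3` data (`-256·256`, `-16·16`). [folklore] -/
theorem fp8_bf16_letters_E4M3 (k : ℕ) :
    ∃ a b : MiniFloat E4M3, a.toRat * b.toRat = fp8_bf16 k := by
  show ∃ a b : MiniFloat E4M3, a.toRat * b.toRat = ([-65536] : List ℚ).getD k (-256)
  rcases getD_mem_or [-65536] (-256) k with h | h
  · rw [List.mem_singleton.mp h]
    exact ⟨⟨true, 15, 0, by decide, by decide, by decide⟩,
      ⟨false, 15, 0, by decide, by decide, by decide⟩, by decide +kernel⟩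
  · rw [h]
    exact ⟨⟨true, 11, 0, by decide, by decide, by decide⟩,
      ⟨false, 11, 0, by decide, by decide, by decide⟩, by decide +kernel⟩

/-- Every letter of `fp8_bf16` is a product of two `E5M2` data (`-256·256`, `-16·16`). [folklore] -/
theorem fp8_bf16_letters_E5M2 (k : ℕ) :
    ∃ a b : MiniFloat E5M2, a.toRat * b.toRat = fp8_bf16 k := by
  show ∃ a b : MiniFloat E5M2, a.toRat * b.toRat = ([-65536] : List ℚ).getD k (-256)
  rcases getD_mem_or [-65536] (-256) k with h | h
  · rw [List.mem_singleton.mp h]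
    exact ⟨⟨true, 23, 0, by decide, by decide, by decide⟩,
      ⟨false, 23, 0, by decide, by decide, by decide⟩, by decide +kernel⟩
  · rw [h]
    exact ⟨⟨true, 19, 0, by decide, by decide, by decide⟩,
      ⟨false, 19, 0, by decide, by decide, by decide⟩, by decide +kernel⟩

/-- Every letter of `fp8_bf16` is a product of an `E4M3` datum and an `E5M2` datum. [folklore] -/
theorem fp8_bf16_letters_E4M3_E5M2 (k : ℕ) :
    ∃ (a : MiniFloat E4M3) (b : MiniFloat E5M2), a.toRat * b.toRat = fp8_bf16 k := by
  show ∃ (a : MiniFloat E4M3) (b : MiniFloat E5M2),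
    a.toRat * b.toRat = ([-65536] : List ℚ).getD k (-256)
  rcases getD_mem_or [-65536] (-256) k with h | h
  · rw [List.mem_singleton.mp h]
    exact ⟨⟨true, 15, 0, by decide, by decide, by decide⟩,
      ⟨false, 23, 0, by decide, by decide, by decide⟩, by decide +kernel⟩
  · rw [h]
    exact ⟨⟨true, 11, 0, by decide, by decide, by decide⟩,
      ⟨false, 19, 0, by decide, by decide, by decide⟩, by decide +kernel⟩

/-- Every letter of `e3m2_bf16` is a product of two `E3M2` data (`-16·16`, `-1·1`). [folklore] -/
theorem e3m2_bf16_letters (k : ℕ) :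
    ∃ a b : MiniFloat E3M2, a.toRat * b.toRat = e3m2_bf16 k := by
  show ∃ a b : MiniFloat E3M2, a.toRat * b.toRat = ([-256] : List ℚ).getD k (-1)
  rcases getD_mem_or [-256] (-1) k with h | h
  · rw [List.mem_singleton.mp h]
    exact ⟨⟨true, 7, 0, by decide, by decide, by decide⟩,
      ⟨false, 7, 0, by decide, by decide, by decide⟩, by decide +kernel⟩
  · rw [h]
    exact ⟨⟨true, 3, 0, by decide, by decide, by decide⟩,
      ⟨false, 3, 0, by decide, by decide, by decide⟩, by decide +kernel⟩

/-- Every letter of `e2m3_bf16` is a product of two `E2M3` data (`-4·4`, `-¼·¼`). [folklore] -/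
theorem e2m3_bf16_letters (k : ℕ) :
    ∃ a b : MiniFloat E2M3, a.toRat * b.toRat = e2m3_bf16 k := by
  show ∃ a b : MiniFloat E2M3, a.toRat * b.toRat = ([-16] : List ℚ).getD k (-1 / 16)
  rcases getD_mem_or [-16] (-1 / 16) k with h | h
  · rw [List.mem_singleton.mp h]
    exact ⟨⟨true, 3, 0, by decide, by decide, by decide⟩,
      ⟨false, 3, 0, by decide, by decide, by decide⟩, by decide +kernel⟩
  · rw [h]
    exact ⟨⟨true, 0, 2, by decide, by decide, by decide⟩,
      ⟨false, 0, 2, by decide, by decide, by decide⟩, by decide +kernel⟩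

/-! #### All-length values: accumulator, exact sum, mass, range -/

/-- `fp8_bf16`: for every `k`, `ŝₖ = -2^16`, `sₖ = -2^16 - 256k`, `Lₖ = 2^16 + 256k`. [folklore] -/
theorem fp8_bf16_spec : ∀ k, (seqSum BFloat16 fp8_bf16 k).toRat = -65536 ∧
    ∑ i ∈ range (k + 1), fp8_bf16 i = -65536 + (k : ℚ) * (-256) ∧
    ∑ i ∈ range (k + 1), |fp8_bf16 i| = 65536 + (k : ℚ) * 256 := by
  have h := tieChain_spec (α := BFloat16) fp8_bf16 0 (-256) (-65536) (-65536) 65536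
    (getD_tail [-65536] _ rfl)
    (by decide +kernel) (by decide +kernel) (by decide +kernel) (by decide +kernel)
  intro k; obtain ⟨h1, h2, h3⟩ := h k (Nat.zero_le _)
  refine ⟨h1, by simpa using h2, ?_⟩
  rw [h3, abs_of_neg (by norm_num)]; push_cast; ring

/-- `fp8_bf16` never leaves the finite range of `bfloat16`. [folklore] -/
theorem fp8_bf16_inRange : ∀ k, InRange BFloat16 fp8_bf16 k :=
  tieChain_inRange (α := BFloat16) fp8_bf16 0 (-256) (-65536) (getD_tail [-65536] _ rfl)
    (by decide +kernel) (by decide +kernel) (by unfold InRange; decide +kernel) (by decide +kernel)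

/-- `e3m2_bf16`: for every `k`, `ŝₖ = -256`, `sₖ = -256 - k`, `Lₖ = 256 + k`. [folklore] -/
theorem e3m2_bf16_spec : ∀ k, (seqSum BFloat16 e3m2_bf16 k).toRat = -256 ∧
    ∑ i ∈ range (k + 1), e3m2_bf16 i = -256 + (k : ℚ) * (-1) ∧
    ∑ i ∈ range (k + 1), |e3m2_bf16 i| = 256 + (k : ℚ) * 1 := by
  have h := tieChain_spec (α := BFloat16) e3m2_bf16 0 (-1) (-256) (-256) 256
    (getD_tail [-256] _ rfl)
    (by decide +kernel) (by decide +kernel) (by decide +kernel) (by decide +kernel)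
  intro k; obtain ⟨h1, h2, h3⟩ := h k (Nat.zero_le _)
  refine ⟨h1, by simpa using h2, ?_⟩
  rw [h3, abs_of_neg (by norm_num)]; push_cast; ring

/-- `e3m2_bf16` never leaves the finite range of `bfloat16`. [folklore] -/
theorem e3m2_bf16_inRange : ∀ k, InRange BFloat16 e3m2_bf16 k :=
  tieChain_inRange (α := BFloat16) e3m2_bf16 0 (-1) (-256) (getD_tail [-256] _ rfl)
    (by decide +kernel) (by decide +kernel) (by unfold InRange; decide +kernel) (by decide +kernel)

/-- `e2m3_bf16`: for every `k`, `ŝₖ = -16`, `sₖ = -16 - k/16`, `Lₖ = 16 + k/16`. [folklore] -/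
theorem e2m3_bf16_spec : ∀ k, (seqSum BFloat16 e2m3_bf16 k).toRat = -16 ∧
    ∑ i ∈ range (k + 1), e2m3_bf16 i = -16 + (k : ℚ) * (-1 / 16) ∧
    ∑ i ∈ range (k + 1), |e2m3_bf16 i| = 16 + (k : ℚ) * (1 / 16) := by
  have h := tieChain_spec (α := BFloat16) e2m3_bf16 0 (-1 / 16) (-16) (-16) 16
    (getD_tail [-16] _ rfl)
    (by decide +kernel) (by decide +kernel) (by decide +kernel) (by decide +kernel)
  intro k; obtain ⟨h1, h2, h3⟩ := h k (Nat.zero_le _)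
  refine ⟨h1, by simpa using h2, ?_⟩
  rw [h3, abs_of_neg (by norm_num)]; push_cast; ring

/-- `e2m3_bf16` never leaves the finite range of `bfloat16`. [folklore] -/
theorem e2m3_bf16_inRange : ∀ k, InRange BFloat16 e2m3_bf16 k :=
  tieChain_inRange (α := BFloat16) e2m3_bf16 0 (-1 / 16) (-16) (getD_tail [-16] _ rfl)
    (by decide +kernel) (by decide +kernel) (by unfold InRange; decide +kernel) (by decide +kernel)

/-! #### The ratios, for every length `n ≥ 1` -/

/-- FP8 products into `bfloat16`, length `n ≥ 1`: `|ŝ - s| / Σ|pᵢ| = (n-1)/(n+255)`. [folklore] -/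
theorem fp8_bf16_ratio (n : ℕ) (hn : 1 ≤ n) :
    |(seqSum BFloat16 fp8_bf16 (n - 1)).toRat - ∑ i ∈ range n, fp8_bf16 i| /
      ∑ i ∈ range n, |fp8_bf16 i| = ((n : ℚ) - 1) / (n + 255) := by
  obtain ⟨k, rfl⟩ : ∃ k, n = k + 1 := ⟨n - 1, by omega⟩
  obtain ⟨h1, h2, h3⟩ := fp8_bf16_spec k
  have hk : (0 : ℚ) ≤ k := Nat.cast_nonneg k
  rw [Nat.add_sub_cancel, h1, h2, h3, abs_of_nonneg (by linarith),
    div_eq_div_iff (by positivity) (by positivity)]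
  push_cast; ring

/-- `E3M2²` into `bfloat16`, length `n ≥ 1`: `|ŝ - s| / Σ|pᵢ| = (n-1)/(n+255)`. [folklore] -/
theorem e3m2_bf16_ratio (n : ℕ) (hn : 1 ≤ n) :
    |(seqSum BFloat16 e3m2_bf16 (n - 1)).toRat - ∑ i ∈ range n, e3m2_bf16 i| /
      ∑ i ∈ range n, |e3m2_bf16 i| = ((n : ℚ) - 1) / (n + 255) := by
  obtain ⟨k, rfl⟩ : ∃ k, n = k + 1 := ⟨n - 1, by omega⟩
  obtain ⟨h1, h2, h3⟩ := e3m2_bf16_spec k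
  have hk : (0 : ℚ) ≤ k := Nat.cast_nonneg k
  rw [Nat.add_sub_cancel, h1, h2, h3, abs_of_nonneg (by linarith),
    div_eq_div_iff (by positivity) (by positivity)]
  push_cast; ring

/-- `E2M3²` into `bfloat16`, length `n ≥ 1`: `|ŝ - s| / Σ|pᵢ| = (n-1)/(n+255)`. [folklore] -/
theorem e2m3_bf16_ratio (n : ℕ) (hn : 1 ≤ n) :
    |(seqSum BFloat16 e2m3_bf16 (n - 1)).toRat - ∑ i ∈ range n, e2m3_bf16 i| /
      ∑ i ∈ range n, |e2m3_bf16 i| = ((n : ℚ) - 1) / (n + 255) := by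
  obtain ⟨k, rfl⟩ : ∃ k, n = k + 1 := ⟨n - 1, by omega⟩
  obtain ⟨h1, h2, h3⟩ := e2m3_bf16_spec k
  have hk : (0 : ℚ) ≤ k := Nat.cast_nonneg k
  rw [Nat.add_sub_cancel, h1, h2, h3, abs_of_nonneg (by linarith),
    div_eq_div_iff (by positivity) (by positivity)]
  push_cast; ring

/-- The common value is the Lange–Rump shape `(n-1)u/(1+(n-1)u)` with `u = 2⁻⁸` the unit roundoff
of `bfloat16`. [folklore] -/
theorem ratio_eq_unitRoundoff (n : ℕ) :
    ((n : ℚ) - 1) / (n + 255) =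
      ((n : ℚ) - 1) * BFloat16.unitRoundoff / (1 + ((n : ℚ) - 1) * BFloat16.unitRoundoff) := by
  have hu : BFloat16.unitRoundoff = 1 / 256 := by
    rw [Format.unitRoundoff]; norm_num [Format.BFloat16]
  have h0 : (0 : ℚ) ≤ n := Nat.cast_nonneg n
  rw [hu, div_eq_div_iff (by positivity)
    (by exact (by linarith : (0 : ℚ) < 1 + ((n : ℚ) - 1) * (1 / 256)).ne')]
  ring

end TieChain

end MiniFloat

end Literature.ComputerArithmetic.FloatingPoint
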